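import Summits.ResolutionOfSingularities.ResolutionOfSingularities.Theorems.HilbertSamuelEliminationSigmaMaxModificationsCorridor3SigmaTameLowSncBranchChain
import Summits.ResolutionOfSingularities.ResolutionOfSingularities.Theorems.HilbertSamuelEliminationSigmaMaxModificationsCorridor3SigmaTameLowSncLineage
import HarnessLib

/-!
# [OURS · L1 W4.2] TAME-LOW row T-L4 «SNC PHASE, lineage-local» — part 5: THE ASSEMBLY — along a lineage of point blow-ups, a finite
# family of branches (prime curve germs with module-finite normalisation, pairwise distinct) together with the exceptional curves born
# along the lineage becomes SNC AT THE LINEAGE POINT FROM SOME STAGE ON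
# (cell res-hironaka, LADDER-RESOLUTION rung L; slot W4.2, crux chain w42 `SigmaMaxModificationsCorridor3` stmt-ResolutionOfSingularities-19249 /
# crux `SigmaMaxModifications` stmt-…-18506; res-L1-w42-plan-1 RULING v3.14-48 (PD)(iv)/(vi)/(PF) row T-L4 → res-L1-w42-stub-4 (gen 7);
# `--supports stmt-ResolutionOfSingularities-19249 --as helper`; consumers: res-D-pv-002 ((TL6) fuel / (γ) SIM instance), res-L1-type-o1
# (`TameLowPrescription`), res-L1-type-o2 (T-L2/T-L6: the TAME-LOW dimension-two stage as a `PointLineage` with `Branch`es))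

HONEST FRAMING.  OURS bookkeeping for the TAME-LOW tier (RULING v3.14-48 (PD)(iv)): the composition of part 4 (singular-branch half: every
branch is eventually a unit or a regular parameter; distinct branches stay distinct; no branch meets an exceptional curve improperly) with
part 3 (regular half: the snc defect in `ℕ ×ₗ ℕ` descends). Classical embedded resolution of a plane curve configuration by point blow-ups
(Zariski; The Stacks Project Tag 0BIC; Hartshorne V.3.9) in LINEAGE-LOCAL, RING-LEVEL form. Nothing here is a statement of H. Hironaka's
manuscript [Hironaka2017] (CANDIDATE, never a premise) nor of Cossart–Jannsen–Saito; no named fact; every theorem PROVED. AI-written; weaker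
than expert review.

THE DATA.  `P : PointLineage K` (part 4e); a finite family `B i : P.Branch (L i)` (`i : ι`, `Fintype ι`) of branches through the initial point
(`(B i).f 0 ∈ 𝔪_{R 0}`), pairwise non-associated there; the EXCEPTIONAL configuration `E n` (`E 0 = ∅`, `E (n+1) = transformAt (R (n+1)) (x n) (E n)`:
the exceptional curve born at each step and the strict transforms of the earlier ones through the lineage point). The configuration at stage
`n` is `config n = {(B i).f n | (B i).f n ∈ 𝔪_{R n}} ∪ E n` (branches still through the lineage point, plus exceptional traces).

* `Branch.notMem_or_regular_succ`, `…_of_le` — «unit or regular parameter» persists; `Branch.passes_of_mem` — in `𝔪` at stage `n` ⇒ passes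
  `0, …, n`; `exc_mem`, `exc_regular`, `exc_distinct`, `Branch.chain_exc_ne_zero` — bookkeeping of the exceptional configuration.
* `config_succ` — past the stage where all branches are units or regular, `config (n+1) = transformAt (R (n+1)) (x n) (config n)`.
* **`eventually_sncAt_config`** — **`∃ N, ∀ n ≥ N, SncAt (P.R n) (config n)`: THE SNC PHASE OF THE TAME-LOW DIMENSION-TWO STAGE TERMINATES
  LINEAGE-LOCALLY.**

References: O. Zariski, P. Samuel II, App. 5 [ZariskiSamuel1960]; The Stacks Project, Tags 0BI7, 0BIC [StacksProject]; R. Hartshorne,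
*Algebraic Geometry*, V Thm. 3.9 [Hartshorne1977]; J. Kollár (2007), Thm. 1.101 [Kollar2007].
-/

noncomputable section

set_option linter.dupNamespace false -- mandated namespace of this single-conjunct summit

open IsLocalRing Literature.AlgebraicGeometry.Resolution
open scoped Classical

namespace Summit.ResolutionOfSingularities.ResolutionOfSingularities.Theorems.SigmaMaxModificationsCorridor3.TameLowSnc

universe u v w

variable {K : Type u} [Field K]

/-! ## §1 One branch: «unit or regular» persists; passing -/

namespace PointLineage.Branch

variable {P : PointLineage K} {L : Type v} [Field L] (B : P.Branch L)

/-- If `f n` is regular then `f (n+1) = f n / x n`. [OURS · proved] -/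
theorem f_succ_of_regular {n : ℕ} (h : IsRegularBranch (P.R n) (B.f n)) : B.f (n + 1) = B.f n / P.x n := by
  obtain ⟨hf, hm, h2⟩ := h
  have hord : contactOrder (0 : P.R n) (B.fR n) = 1 := by
    rw [← Nat.cast_one, contactOrder_zero_iff, pow_one]; exact ⟨hm, h2⟩
  rw [B.f_succ n, hord, ENat.toNat_one, pow_one]

/-- If `f n` is a unit then `f (n+1) = f n`. [OURS · proved] -/
theorem f_succ_of_notMem {n : ℕ} (h : B.fR n ∉ maximalIdeal (P.R n)) : B.f (n + 1) = B.f n := by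
  have hord : contactOrder (0 : P.R n) (B.fR n) = 0 := contactOrder_eq_zero_of_not_mem (Ideal.zero_mem _) h
  rw [B.f_succ n, hord, ENat.toNat_zero, pow_zero, div_one]

/-- **«Unit or regular parameter» persists to the next stage.** [OURS · proved] -/
theorem notMem_or_regular_succ {n : ℕ} (h : B.fR n ∉ maximalIdeal (P.R n) ∨ IsRegularBranch (P.R n) (B.f n)) :
    B.fR (n + 1) ∉ maximalIdeal (P.R (n + 1)) ∨ IsRegularBranch (P.R (n + 1)) (B.f (n + 1)) := by
  rcases h with hu | hr
  · left
    have hunit : IsUnit (B.fR n) := not_not.mp fun h' => hu ((mem_maximalIdeal _).mpr h')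
    have e : B.fR (n + 1) = Subring.inclusion (P.quadratic n).dominates.1 (B.fR n) :=
      Subtype.ext (by change B.f (n + 1) = B.f n; exact B.f_succ_of_notMem hu)
    rw [e]; exact fun hm => (mem_maximalIdeal _).mp hm (hunit.map _)
  · have hf1 := B.f_succ_of_regular hr
    obtain ⟨hf, hm, h2⟩ := hr
    have hdiv : B.f n / P.x n ∈ P.R (n + 1) := hf1 ▸ B.f_mem (n + 1)
    by_cases hmem : (⟨B.f n / P.x n, hdiv⟩ : P.R (n + 1)) ∈ maximalIdeal (P.R (n + 1))
    · right
      have h := (frame_transformAt (P.dim_eq n) (P.dim_eq (n + 1)) (P.quadratic n) (P.x_mem_maximalIdeal n) (P.xR_ne_zero n)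
        (P.blowupRing_le n) (g := B.fR n) hm h2 hmem).2.2
      rw [hf1]; exact h
    · left
      have e : B.fR (n + 1) = ⟨B.f n / P.x n, hdiv⟩ := Subtype.ext hf1
      rw [e]; exact hmem

/-- **«Unit or regular parameter» persists to all later stages.** [OURS · proved] -/
theorem notMem_or_regular_of_le {N n : ℕ} (hNn : N ≤ n)
    (h : B.fR N ∉ maximalIdeal (P.R N) ∨ IsRegularBranch (P.R N) (B.f N)) :
    B.fR n ∉ maximalIdeal (P.R n) ∨ IsRegularBranch (P.R n) (B.f n) := by
  induction n, hNn using Nat.le_induction with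
  | base => exact h
  | succ n _ ih => exact B.notMem_or_regular_succ ih

/-- **Eventually unit or regular, uniformly in later stages** (part 4d). [OURS · proved] -/
theorem exists_forall_notMem_or_regular :
    ∃ N, ∀ n, N ≤ n → B.fR n ∉ maximalIdeal (P.R n) ∨ IsRegularBranch (P.R n) (B.f n) := by
  obtain ⟨N, hN⟩ := B.exists_not_mem_or_isRegularBranch
  exact ⟨N, fun n hn => B.notMem_or_regular_of_le hn hN⟩

/-- If `f (n+1) ∈ 𝔪` then `f n ∈ 𝔪` (units persist). [OURS · proved] -/
theorem mem_of_mem_succ {n : ℕ} (h : B.fR (n + 1) ∈ maximalIdeal (P.R (n + 1))) : B.fR n ∈ maximalIdeal (P.R n) := by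
  by_contra hu
  rcases B.notMem_or_regular_succ (Or.inl hu) with h1 | h1
  · exact h1 h
  · -- regular at `n+1` is fine for membership; but a unit at `n` gives a unit at `n+1`
    have hunit : IsUnit (B.fR n) := not_not.mp fun h' => hu ((mem_maximalIdeal _).mpr h')
    have e : B.fR (n + 1) = Subring.inclusion (P.quadratic n).dominates.1 (B.fR n) :=
      Subtype.ext (by change B.f (n + 1) = B.f n; exact B.f_succ_of_notMem hu)
    exact (mem_maximalIdeal _).mp h (e ▸ hunit.map _)

/-- **In `𝔪` at stage `n` ⇒ the branch passes through `0, …, n`.** [OURS · proved] -/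
theorem passes_of_mem {n : ℕ} (h : B.fR n ∈ maximalIdeal (P.R n)) : B.Passes n := by
  induction n with
  | zero => intro k hk; rw [Nat.le_zero.mp hk]; exact h
  | succ n ih =>
    intro k hk
    rcases Nat.lt_or_ge k (n + 1) with hlt | hge
    · exact ih (B.mem_of_mem_succ h) k (Nat.lt_succ_iff.mp hlt)
    · rw [le_antisymm hk hge]; exact h

end PointLineage.Branch

/-! ## §2 The exceptional configuration -/

section Exceptional

variable (P : PointLineage K) {E : ℕ → Finset K} (hE0 : E 0 = ∅)
  (hE : ∀ n, E (n + 1) = transformAt (P.R (n + 1)) (P.x n) (E n))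

include hE0 hE in
/-- Members of `E n` lie in `R n`, are regular parameters, and are pairwise of finite contact. [OURS · proved] -/
theorem exc_regular_and_distinct (n : ℕ) :
    (∀ e ∈ E n, IsRegularBranch (P.R n) e) ∧ (∀ e ∈ E n, ∀ e' ∈ E n, e ≠ e' → contactAt (P.R n) e e' ≠ ⊤) := by
  induction n with
  | zero => rw [hE0]; exact ⟨fun e he => absurd he (Finset.notMem_empty e), fun e he => absurd he (Finset.notMem_empty e)⟩
  | succ n ih =>
    rw [hE n]
    exact ⟨isRegularBranch_transformAt (P.dim_eq n) (P.dim_eq (n + 1)) (P.quadratic n) (P.x_mem_maximalIdeal n)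
        (P.xR_ne_zero n) (P.blowupRing_le n) ih.1,
      contactAt_ne_top_transformAt (P.dim_eq n) (P.dim_eq (n + 1)) (P.quadratic n) (P.x_mem_maximalIdeal n)
        (P.xR_ne_zero n) (P.blowupRing_le n) ih.1 ih.2⟩

include hE0 hE in
/-- **The points of a branch do not kill the exceptional configuration**: `θₙ (e) ≠ 0` for `e ∈ E n` (while the branch passes).
[OURS · proved] -/
theorem chain_exc_ne_zero {L : Type v} [Field L] (B : P.Branch L) (n : ℕ) (h : B.Passes n) :
    ∀ e ∈ E n, ∃ he : e ∈ P.R n, (B.chain n h).1 ⟨e, he⟩ ≠ 0 := by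
  induction n with
  | zero => rw [hE0]; exact fun e he => absurd he (Finset.notMem_empty e)
  | succ n ih =>
    intro e he
    rw [hE n] at he
    rcases mem_transformAt_iff.mp he with rfl | ⟨e', he', rfl, heR, -⟩
    · exact ⟨(P.quadratic n).dominates.1 (P.x_mem n), B.chain_chart_ne_zero (Nat.lt_succ_self n) h⟩
    · obtain ⟨he'R, hne⟩ := ih h.of_succ e' he'
      exact ⟨heR, B.chain_div_ne_zero h he'R hne heR⟩

end Exceptional

/-- In a local domain, if a non-unit `e` divides a prime `f` then `f` divides `e` (they are associated). [folklore] -/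
theorem dvd_of_dvd_of_prime {A : Type u} [CommRing A] [IsDomain A] [IsLocalRing A] {e f : A} (he : e ∈ maximalIdeal A) (hf : Prime f)
    (hef : e ∣ f) : f ∣ e := by
  obtain ⟨c, hc⟩ := hef
  rcases hf.dvd_or_dvd (show f ∣ e * c from ⟨1, by rw [mul_one, hc]⟩) with h1 | h1
  · exact h1
  · exfalso
    obtain ⟨c', hc'⟩ := h1
    have e1 : f * 1 = f * (e * c') := by
      rw [mul_one]
      conv_lhs => rw [hc, hc']
      ring
    have e2 := mul_left_cancel₀ hf.ne_zero e1
    exact (mem_maximalIdeal _).mp he (isUnit_iff_exists_inv.mpr ⟨c', e2.symm⟩)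

/-! ## §3 The configuration and the assembly -/

section Assembly

variable (P : PointLineage K) {ι : Type w} [Fintype ι] {L : ι → Type v} [∀ i, Field (L i)] (B : ∀ i, P.Branch (L i))
  (E : ℕ → Finset K)

/-- **The configuration at stage `n`**: the strict transforms of the branches still through the lineage point, and the exceptional
configuration. [OURS · L1 W4.2 bookkeeping] -/
def config (n : ℕ) : Finset K :=
  ((Finset.univ.image fun i => (B i).f n).filter fun g => ∃ h : g ∈ P.R n, (⟨g, h⟩ : P.R n) ∈ maximalIdeal (P.R n)) ∪ E n

variable {P B E}

/-- Membership in the configuration. [OURS · proved] -/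
theorem mem_config_iff {n : ℕ} {g : K} :
    g ∈ config P B E n ↔ (∃ i, g = (B i).f n ∧ (B i).fR n ∈ maximalIdeal (P.R n)) ∨ g ∈ E n := by
  unfold config
  simp only [Finset.mem_union, Finset.mem_filter, Finset.mem_image, Finset.mem_univ, true_and]
  constructor
  · rintro (⟨⟨i, rfl⟩, hR, hm⟩ | h)
    · exact Or.inl ⟨i, rfl, hm⟩
    · exact Or.inr h
  · rintro (⟨i, rfl, hm⟩ | h)
    · exact Or.inl ⟨⟨i, rfl⟩, (B i).f_mem n, hm⟩
    · exact Or.inr h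

variable (hE0 : E 0 = ∅) (hE : ∀ n, E (n + 1) = transformAt (P.R (n + 1)) (P.x n) (E n))

include hE in
/-- **The configuration evolves by `transformAt`** once every branch is a unit or a regular parameter. [OURS · proved] -/
theorem config_succ {N₀ : ℕ} (hN₀ : ∀ i n, N₀ ≤ n → (B i).fR n ∉ maximalIdeal (P.R n) ∨ IsRegularBranch (P.R n) ((B i).f n))
    {n : ℕ} (hn : N₀ ≤ n) : config P B E (n + 1) = transformAt (P.R (n + 1)) (P.x n) (config P B E n) := by
  ext g
  rw [mem_config_iff, mem_transformAt_iff, hE n, mem_transformAt_iff]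
  constructor
  · rintro (⟨i, rfl, hm⟩ | hx | ⟨e', he', rfl, hm⟩)
    · -- a branch through the point at `n+1`: it was regular at `n`, so `f (n+1) = f n / x n`
      right
      have hmn : (B i).fR n ∈ maximalIdeal (P.R n) := (B i).mem_of_mem_succ hm
      have hreg : IsRegularBranch (P.R n) ((B i).f n) := (hN₀ i n hn).resolve_left (fun h => h hmn)
      refine ⟨(B i).f n, mem_config_iff.mpr (Or.inl ⟨i, rfl, hmn⟩), (B i).f_succ_of_regular hreg, (B i).f_mem (n + 1), hm⟩
    · exact Or.inl hx
    · exact Or.inr ⟨e', mem_config_iff.mpr (Or.inr he'), rfl, hm⟩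
  · rintro (rfl | ⟨g', hg', rfl, hgR, hm⟩)
    · exact Or.inr (Or.inl rfl)
    · rcases mem_config_iff.mp hg' with ⟨i, rfl, hmn⟩ | he'
      · left
        have hreg : IsRegularBranch (P.R n) ((B i).f n) := (hN₀ i n hn).resolve_left (fun h => h hmn)
        have hf1 := (B i).f_succ_of_regular hreg
        refine ⟨i, hf1.symm, ?_⟩
        have e : (B i).fR (n + 1) = ⟨(B i).f n / P.x n, hgR⟩ := Subtype.ext hf1
        rw [e]; exact hm
      · exact Or.inr (Or.inr ⟨g', he', rfl, hgR, hm⟩)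

include hE0 hE in
/-- **Regularity and distinctness of the configuration at a stage where every branch is a unit or regular**, given pairwise
non-association of the branches at stage `0`. [OURS · proved] -/
theorem config_regular_and_distinct (h0 : ∀ i, (B i).fR 0 ∈ maximalIdeal (P.R 0))
    (hdist : ∀ i j, i ≠ j → ¬ (B i).fR 0 ∣ (B j).fR 0) {n : ℕ}
    (hN : ∀ i, (B i).fR n ∉ maximalIdeal (P.R n) ∨ IsRegularBranch (P.R n) ((B i).f n)) :
    (∀ g ∈ config P B E n, IsRegularBranch (P.R n) g) ∧
      (∀ g ∈ config P B E n, ∀ g' ∈ config P B E n, g ≠ g' → contactAt (P.R n) g g' ≠ ⊤) := by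
  have _ := h0
  obtain ⟨hEreg, hEdist⟩ := exc_regular_and_distinct P hE0 hE n
  have hreg : ∀ g ∈ config P B E n, IsRegularBranch (P.R n) g := by
    intro g hg
    rcases mem_config_iff.mp hg with ⟨i, rfl, hm⟩ | he
    · exact (hN i).resolve_left (fun h => h hm)
    · exact hEreg g he
  refine ⟨hreg, ?_⟩
  -- symmetric non-divisibility suffices: both are regular parameters, hence primes
  have key : ∀ g ∈ config P B E n, ∀ g' ∈ config P B E n, g ≠ g' →
      ∃ (hg : g ∈ P.R n) (hg' : g' ∈ P.R n), ¬ (⟨g, hg⟩ : P.R n) ∣ ⟨g', hg'⟩ := by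
    intro g hg g' hg' hne
    rcases mem_config_iff.mp hg with ⟨i, rfl, hmi⟩ | he
    · rcases mem_config_iff.mp hg' with ⟨j, rfl, hmj⟩ | he'
      · have hij : i ≠ j := fun e => hne (by rw [e])
        exact ⟨(B i).f_mem n, (B j).f_mem n, (B i).not_dvd_of_passes (B j) (hdist i j hij) ((B i).passes_of_mem hmi)⟩
      · obtain ⟨he'R, hne0⟩ := chain_exc_ne_zero P hE0 hE (B i) n ((B i).passes_of_mem hmi) g' he'
        exact ⟨(B i).f_mem n, he'R, (B i).not_dvd_of_chain_ne_zero _ hne0⟩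
    · rcases mem_config_iff.mp hg' with ⟨j, rfl, hmj⟩ | he'
      · -- `e ∤ f`: else the primes `e`, `f` are associated and `f ∣ e`
        obtain ⟨heR, hne0⟩ := chain_exc_ne_zero P hE0 hE (B j) n ((B j).passes_of_mem hmj) g he
        have hfe := (B j).not_dvd_of_chain_ne_zero _ hne0
        have hereg := hEreg g he
        obtain ⟨heR', hem, -⟩ := hereg
        have hfreg : IsRegularBranch (P.R n) ((B j).f n) := (hN j).resolve_left (fun h => h hmj)
        obtain ⟨hfR', hfm, hf2⟩ := hfreg
        have hfp : Prime ((B j).fR n) := IsRegularLocalRing.prime_of_not_mem_sq hfm hf2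
        exact ⟨heR, (B j).f_mem n, fun hef => hfe (dvd_of_dvd_of_prime hem hfp hef)⟩
      · obtain ⟨heR, -, -⟩ := hEreg g he
        obtain ⟨he'R, -, -⟩ := hEreg g' he'
        refine ⟨heR, he'R, fun hdvd => hEdist g he g' he' hne ?_⟩
        rw [show g = ((⟨g, heR⟩ : P.R n) : K) from rfl, show g' = ((⟨g', he'R⟩ : P.R n) : K) from rfl, contactAt_eq,
          contactOrder_eq_top_iff]
        exact fun k => Ideal.mem_sup_left (Ideal.mem_span_singleton.mpr hdvd)
  intro g hg g' hg' hne
  obtain ⟨hgR, hg'R, hndvd⟩ := key g hg g' hg' hne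
  have hgreg := hreg g hg
  obtain ⟨hgR'', hgm, -⟩ := hgreg
  rw [show g = ((⟨g, hgR⟩ : P.R n) : K) from rfl, show g' = ((⟨g', hg'R⟩ : P.R n) : K) from rfl, contactAt_eq]
  exact contactOrder_ne_top_of_not_dvd hgm hndvd

include hE0 hE in
/-- **THE SNC PHASE OF THE TAME-LOW DIMENSION-TWO STAGE TERMINATES, LINEAGE-LOCALLY.**  Along a lineage `P` of point blow-ups through
two-dimensional regular local rings, for a finite family of branches `B i` through the initial point (each with a point `θ₀` of
module-finite normalisation), pairwise non-associated at stage `0`, and the exceptional configuration `E` (`E 0 = ∅`,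
`E (n+1) = transformAt … (E n)`): **from some stage on, the configuration `config n` (branches through the lineage point + exceptional
traces) is snc at the lineage point** — at most two members, each a regular parameter, any two transversal.
[OURS · proved; classical embedded resolution of plane curve configurations in lineage-local ring-level form] -/
theorem eventually_sncAt_config (h0 : ∀ i, (B i).fR 0 ∈ maximalIdeal (P.R 0))
    (hdist : ∀ i j, i ≠ j → ¬ (B i).fR 0 ∣ (B j).fR 0) :
    ∃ N, ∀ n, N ≤ n → SncAt (P.R n) (config P B E n) := by
  -- a common stage past which every branch is a unit or regular
  have hN : ∀ i, ∃ N, ∀ n, N ≤ n → (B i).fR n ∉ maximalIdeal (P.R n) ∨ IsRegularBranch (P.R n) ((B i).f n) :=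
    fun i => (B i).exists_forall_notMem_or_regular
  choose N hN using hN
  set N₀ := Finset.univ.sup N with hN₀
  have hN₀' : ∀ i n, N₀ ≤ n → (B i).fR n ∉ maximalIdeal (P.R n) ∨ IsRegularBranch (P.R n) ((B i).f n) :=
    fun i n hn => hN i n ((Finset.le_sup (Finset.mem_univ i)).trans hn)
  -- the shifted lineage from `N₀`
  obtain ⟨hregN, hfinN⟩ := config_regular_and_distinct hE0 hE h0 hdist (fun i => hN₀' i N₀ le_rfl)
  obtain ⟨M, hM⟩ := eventually_sncAt_of_lineage (R := fun k => P.R (N₀ + k)) (fun k => P.isRegular (N₀ + k))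
    (fun k => P.dim_eq (N₀ + k)) (fun k => P.quadratic (N₀ + k)) (x := fun k => P.x (N₀ + k)) (fun k => P.x_mem (N₀ + k))
    (fun k => P.x_mem_maximalIdeal (N₀ + k)) (fun k => P.x_ne_zero (N₀ + k)) (fun k => P.blowupRing_le (N₀ + k))
    (B := fun k => config P B E (N₀ + k)) (fun k => config_succ hE hN₀' (Nat.le_add_right N₀ k)) (N₀ := 0)
    (by simpa using hregN) (by simpa using hfinN)
  refine ⟨N₀ + M, fun n hn => ?_⟩
  obtain ⟨k, rfl⟩ := Nat.exists_eq_add_of_le ((Nat.le_add_right N₀ M).trans hn)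
  exact hM k (by omega)

end Assembly

end Summit.ResolutionOfSingularities.ResolutionOfSingularities.Theorems.SigmaMaxModificationsCorridor3.TameLowSnc

end
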